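import Mathlib
import Summits.Ventures.PercRepro2.HCov
import Summits.Ventures.PercRepro2.RootLeafUSigns
import Summits.Ventures.PercRepro2.RootLeafUHalf
import Summits.Ventures.PercRepro2.RootLeafUCore
import Summits.Ventures.PercRepro2.RootLeafUYA
import Summits.Ventures.PercRepro2.RootLeafUYBF

/-!
# (G4-u): the general `(YB)` reduced to `(F_W)` — the reduction that KEEPS the `c ∈ L` terms
(blind cell PercRepro2, p4 g10; proofs/P4-G10-YBF.md §8)

RootLeafUYBF reduced `(YB)` to `(F)` by first dropping the `c ∈ L` regime; NEG-171 (engine D332) shows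
`(F)` — and the `c ∈ L`-free core `(YB_R)` — FALSE as general inequalities (the dropped term
`b′·(Y_N − d0·Y)` is what keeps `(YB)` positive on the witnesses).  Here the same `d0`-linearity is
used on the FULL `(YB)`: `(YB) = d0·(Z·M − B·Y) + (D·M + Y_N·B₀)` with `Z = P(Q)`, `B = P(Q, bL)`,
`B₀ = P(Q, a₂ ↮ c, bL)`, `Y = P(R, oL)`, `D = P(PD)`, `M = P(T, oL, bL)`, `Y_N = P(PD, oL)`; when the
coefficient is negative, Harris `d0·W ≤ D` (`YBF.d0_mul_W_le_D`, `W = P(R)`) gives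
`W·(YB) ≥ D·(Z·M − B·Y) + W·(D·M + Y_N·B₀) =: (F_W)`, so

  **`(F_W) := (Z + W)·D·M + W·Y_N·B₀ − D·B·Y ≥ 0 ⟹ (YB) ≥ 0 ⟹ 0 ≤ T2oL`**

(`YB_nonneg_of_FW`, `T2oL_nonneg_of_FW`, `HCov_root_leaf_u_of_FW`).  `(F_W)` is NOT tight on the
two-path gadgets (relative slack 0.4–0.97 where `(F)` is an equality) and holds on NEG-171's witnesses
W1 (`+4.6·10⁻⁸`) and W2, the pendant-root gadgets, and a CALIBRATED random census of 15,261,570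
instances (n = 5–7, m ≤ 10, near-one palettes; kit j254092: `(YB)` 0, `(F_W)` 0, `(F)` 50 violations —
the sampler sees `(F)`'s failures); no degree-3 atom-multiplier certificate exists in the Harris /
tower / functional-BHK family (kit j254640, infeasible; `(SW2)` control certified) — a CONDITIONAL
theorem until `(F_W)` is proved or refuted (the engine's exhaustive bar asked).
-/

namespace Summit.Ventures.PercRepro2

open UnionCluster CovForm

namespace RootLeafU

namespace YBF

section AlgebraW

variable {R : Type*} [Field R] [LinearOrder R] [IsStrictOrderedRing R]

/-- The algebra of `(YB) ≥ 0` from `(F_W)`: `(YB) = d0·(Z·M − B·Y) + (D·M + Y_N·B₀)` and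
`W·(YB) = (F_W) + (D − d0·W)·(B·Y − Z·M)` when the coefficient is negative. -/
lemma yb_of_fw_alg {d0 D t tp YN Yt M bN B1 bp : R} (hd0 : 0 ≤ d0) (hD : 0 ≤ D) (ht : 0 ≤ t)
    (hYN : 0 ≤ YN) (hYt : 0 ≤ Yt) (hM : 0 ≤ M) (hbN : 0 ≤ bN)
    (hbp : 0 ≤ bp) (hMt : M ≤ t) (hYtt : Yt ≤ t) (hYND : YN ≤ D) (hd0W : d0 * (D + t) ≤ D)
    (hFW : D * (bN + B1 + bp) * (YN + Yt) ≤
      (D + t + tp + (D + t)) * D * M + (D + t) * YN * (bN + bp)) :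
    0 ≤ (d0 * (D + t + tp) + D) * M + YN * (bN + bp) - d0 * (bN + B1 + bp) * (YN + Yt) := by
  by_cases h : 0 ≤ (D + t + tp) * M - (bN + B1 + bp) * (YN + Yt)
  · have h1 : 0 ≤ d0 * ((D + t + tp) * M - (bN + B1 + bp) * (YN + Yt)) := mul_nonneg hd0 h
    have h2 : 0 ≤ D * M := mul_nonneg hD hM
    have h3 : 0 ≤ YN * (bN + bp) := mul_nonneg hYN (add_nonneg hbN hbp)
    linarith
  · have h' : (D + t + tp) * M - (bN + B1 + bp) * (YN + Yt) < 0 := not_le.mp h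
    have hWX : 0 ≤ (D + t) * ((d0 * (D + t + tp) + D) * M + YN * (bN + bp) -
        d0 * (bN + B1 + bp) * (YN + Yt)) := by
      have e : (D + t) * ((d0 * (D + t + tp) + D) * M + YN * (bN + bp) -
          d0 * (bN + B1 + bp) * (YN + Yt)) =
          ((D + t + tp + (D + t)) * D * M + (D + t) * YN * (bN + bp) -
              D * (bN + B1 + bp) * (YN + Yt)) +
            (D - d0 * (D + t)) * ((bN + B1 + bp) * (YN + Yt) - (D + t + tp) * M) := by ring
      rw [e]
      exact add_nonneg (by linarith) (mul_nonneg (by linarith) (by linarith [h']))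
    rcases eq_or_lt_of_le (add_nonneg hD ht) with hW0 | hWpos
    · have hD0 : D = 0 := by linarith
      have ht0 : t = 0 := by linarith
      have hM0 : M = 0 := by linarith
      have hYN0 : YN = 0 := by linarith
      have hYt0 : Yt = 0 := by linarith
      rw [hD0, ht0, hM0, hYN0, hYt0]
      ring_nf
      exact le_refl 0
    · exact (mul_nonneg_iff_of_pos_left hWpos).1 hWX

end AlgebraW

section ReductionW

variable {V : Type*} {E : Type*} [Fintype E] [DecidableEq E] [Fintype V] [DecidableEq V]
  {R : Type*} [Field R] [LinearOrder R] [IsStrictOrderedRing R]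

variable (p : E → R) (ends : E → Sym2 V) (o a₂ c b u : V)

omit [Fintype V] in
/-- **`(YB) ≥ 0` from `(F_W)`**: if `D·B·Y ≤ (Z + W)·D·M + W·Y_N·B₀` (`Z = P(Q)`, `W = P(R)`,
`D = P(PD)`, `M = P(T,oL,bL)`, `Y_N = P(PD,oL)`, `B₀ = P(PD,bL) + P(T′,bL)`, `B = P(Q,bL)`,
`Y = P(R,oL)`), then the general `(YB)` (the second summand of `T2oL_eq_YA_add_YB`) is non-negative. -/
theorem YB_nonneg_of_FW (hp : IsProbVec p)
    (hFW : prob p (PDEvent ends u a₂ c) * prob p (avoidAll ends a₂ {u} ∩ connEvent ends u b) *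
        prob p (avoidAll ends u {a₂, c} ∩ connEvent ends u o) ≤
      (prob p (avoidAll ends a₂ {u}) + prob p (avoidAll ends u {a₂, c})) * prob p (PDEvent ends u a₂ c) *
          prob p (TEvent ends u a₂ c ∩ (connEvent ends u o ∩ connEvent ends u b)) +
        prob p (avoidAll ends u {a₂, c}) * prob p (PDEvent ends u a₂ c ∩ connEvent ends u o) *
          (prob p (PDEvent ends u a₂ c ∩ connEvent ends u b) +
            prob p (TEvent ends a₂ u c ∩ connEvent ends u b))) :
    0 ≤ (prob p (avoidAll ends a₂ {c}) * prob p (avoidAll ends a₂ {u}) + prob p (PDEvent ends u a₂ c)) *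
          prob p (TEvent ends u a₂ c ∩ (connEvent ends u o ∩ connEvent ends u b)) +
        prob p (PDEvent ends u a₂ c ∩ connEvent ends u o) *
          (prob p (PDEvent ends u a₂ c ∩ connEvent ends u b) +
            prob p (TEvent ends a₂ u c ∩ connEvent ends u b)) -
        prob p (avoidAll ends a₂ {c}) * prob p (avoidAll ends a₂ {u} ∩ connEvent ends u b) *
          (prob p (PDEvent ends u a₂ c ∩ connEvent ends u o) +
            prob p (TEvent ends u a₂ c ∩ connEvent ends u o)) := by
  have hW : prob p (avoidAll ends u {a₂, c}) =
      prob p (PDEvent ends u a₂ c) + prob p (TEvent ends u a₂ c) := by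
    have h' := ISplit.prob_PD_add_T p ends u a₂ c Set.univ
    simp only [Set.inter_univ] at h'
    exact h'.symm
  have hY := ISplit.prob_PD_add_T p ends u a₂ c (connEvent ends u o)
  have hZ := Qsplit_univ p ends u a₂ c
  have hQbL := Qsplit p ends u a₂ c (connEvent ends u b)
  have hd0W := d0_mul_W_le_D p ends a₂ c u hp
  rw [hW] at hd0W
  rw [hW, ← hY, hZ, hQbL] at hFW
  have hMt : prob p (TEvent ends u a₂ c ∩ (connEvent ends u o ∩ connEvent ends u b)) ≤
      prob p (TEvent ends u a₂ c) := prob_mono hp Set.inter_subset_left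
  have hYtt : prob p (TEvent ends u a₂ c ∩ connEvent ends u o) ≤ prob p (TEvent ends u a₂ c) :=
    prob_mono hp Set.inter_subset_left
  have hYND : prob p (PDEvent ends u a₂ c ∩ connEvent ends u o) ≤ prob p (PDEvent ends u a₂ c) :=
    prob_mono hp Set.inter_subset_left
  rw [hZ, hQbL]
  exact yb_of_fw_alg (prob_nonneg hp _) (prob_nonneg hp _) (prob_nonneg hp _) (prob_nonneg hp _)
    (prob_nonneg hp _) (prob_nonneg hp _) (prob_nonneg hp _) (prob_nonneg hp _) hMt hYtt hYND hd0W hFW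

/-- **`0 ≤ T2oL` from `(F_W)`**. -/
theorem T2oL_nonneg_of_FW (hp : IsProbVec p)
    (hFW : prob p (PDEvent ends u a₂ c) * prob p (avoidAll ends a₂ {u} ∩ connEvent ends u b) *
        prob p (avoidAll ends u {a₂, c} ∩ connEvent ends u o) ≤
      (prob p (avoidAll ends a₂ {u}) + prob p (avoidAll ends u {a₂, c})) * prob p (PDEvent ends u a₂ c) *
          prob p (TEvent ends u a₂ c ∩ (connEvent ends u o ∩ connEvent ends u b)) +
        prob p (avoidAll ends u {a₂, c}) * prob p (PDEvent ends u a₂ c ∩ connEvent ends u o) *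
          (prob p (PDEvent ends u a₂ c ∩ connEvent ends u b) +
            prob p (TEvent ends a₂ u c ∩ connEvent ends u b))) :
    0 ≤ T2oL p ends o a₂ c b u := by
  rw [T2oL_eq_YA_add_YB]
  have hA := YA_nonneg p ends o a₂ c b u hp
  have hB := YB_nonneg_of_FW p ends o a₂ c b u hp hFW
  linarith

/-- **(G4-u) from `(F_W)` and the `o ∈ K` half** for the root `a₁` a leaf at the unmarked `u`. -/
theorem HCov_root_leaf_u_of_FW (hp : IsProbVec p) {f : E} {a₁ : V} (hf : ends f = s(a₁, u))
    (hleaf : ∀ e, a₁ ∈ ends e → e = f) (h1u : a₁ ≠ u) (h12 : a₁ ≠ a₂) (h1c : a₁ ≠ c)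
    (h1o : a₁ ≠ o) (h1b : a₁ ≠ b)
    (hFW : prob p (PDEvent ends u a₂ c) * prob p (avoidAll ends a₂ {u} ∩ connEvent ends u b) *
        prob p (avoidAll ends u {a₂, c} ∩ connEvent ends u o) ≤
      (prob p (avoidAll ends a₂ {u}) + prob p (avoidAll ends u {a₂, c})) * prob p (PDEvent ends u a₂ c) *
          prob p (TEvent ends u a₂ c ∩ (connEvent ends u o ∩ connEvent ends u b)) +
        prob p (avoidAll ends u {a₂, c}) * prob p (PDEvent ends u a₂ c ∩ connEvent ends u o) *
          (prob p (PDEvent ends u a₂ c ∩ connEvent ends u b) +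
            prob p (TEvent ends a₂ u c ∩ connEvent ends u b)))
    (hK : 0 ≤ T2oK p ends o a₂ c b u) (h3 : HCov p ends o u a₂ c b) : HCov p ends o a₁ a₂ c b :=
  HCov_root_leaf_u_of p ends hp hf hleaf h1u h12 h1c h1o h1b
    (T2_nonneg_of_halves p ends o a₂ c b u (T2oL_nonneg_of_FW p ends o a₂ c b u hp hFW) hK) h3

end ReductionW

end YBF

end RootLeafU

end Summit.Ventures.PercRepro2
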